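import Summits.HodgeConjecture.HodgeConjecture.Theorems.F0LD1CharSeamOfMeets
import Summits.HodgeConjecture.HodgeConjecture.Theorems.F0LD1CharThetaSpaceLeOfIrreducible
import Summits.HodgeConjecture.HodgeConjecture.Theorems.HLiu418S1BettiSliceExclusion
import Literature.NumberTheory.Automorphic.Liu2021.ThetaLiftFromLineIrreducible
import Literature.NumberTheory.Rogawski1990.CurveThetaCohFinComponentUnique
import HarnessLib

-- As in the lineage (★ `ThetaLiftFromLineCentralCharacter`): statements over the theta-kernel datum elaborate to very large types; elaborate sequentially.
set_option Elab.async false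

/-!
# Crux `HLiu418`, line LD1 — THE CLOSER OF ORGAN (I) `stub_thetaCharRigid : ThetaCharRigid₂` MODULO THE LETTER-ORGAN (I′) `ThetaSpaceIrreducible₂`
# («the closed theta span of a character of the line is irreducible», [Liu2021, Cor. B.6 (1)] ∕ [Wu2013, Thm. 5.3], ★ predicate `Liu2021.ThetaLiftFromLineIrreducible`)

Cell hodgecm-mathlib (D-0151), FLOOR 0; crux item `HLiu418` = stmt-HodgeConjecture-24832; half-A line LD1, leaf `Cruxes/HLiu418/Lines/F0_P6LD_StubS1FactsThetaRoad.lean`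
(LD1-plan (g0); organ (I) `ThetaCharRigid₂` :411, vocabulary `CharSeam₂` :217 ∕ `CharThetaSpaceLe₂` :249).  Seat LD1-p01 (g0), LD1-plan RULING (I-A) 2026-09-02T04:08Z
(files F1 ★ `F0LD1CharThetaSpaceLeOfIrreducible`, F2 = this file, F3 ★ `Liu2021/ThetaLiftFromLineIrreducible`).  THEOREMS ONLY (no `def`, no instance, no notation,
no named fact, no `sorry`); `--supports stmt-HodgeConjecture-24832`.  The Lines module is NOT imported (the leaf's ED. 2 imports THIS file): the organ texts are repeated
BY VALUE — the conclusion of `thetaCharRigid₂_of_irred` is the body of `ThetaCharRigid₂` with `CharThetaSpaceLe₂` ∕ `CharSeam₂` unfolded, token for token, and its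
hypothesis is the body of the new letter-organ (I′) `ThetaSpaceIrreducible₂` (= the closure of ★ `Liu2021.ThetaLiftFromLineIrreducible` over the CM curve frames with
the pinned transport), so that the leaf's ED. 2 reads `theorem stub_thetaCharRigid : ThetaCharRigid₂ := F0LD1ThetaCharRigidOfIrred.thetaCharRigid₂_of_irred
stub_thetaSpaceIrreducible`.  HC_CM is proved only modulo the 7 printed citations (2 remaining: hLiu418 = stmt-HodgeConjecture-24832, h413 =
stmt-HodgeConjecture-24833) until rung 0 closes; this file discharges nothing printed — it converts organ (I) into the letter (I′) (count-neutral re-lettering).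

PROOF (the θ-road's (I) = (I-B) ∧ (I-A), [Liu2021, proof of Prop. 4.13 Case 1 ∕ Cor. B.6 p. 99]): `[U(H)]` is compact (definiteness off `ι`, ★
`S1BettiSliceExclusion.anisotropic_of_formCongr_posDef`, ★ `compactSpace_adelicGroupData_automorphicQuotient`); (I-B) ★ `F0LD1CharSeamOfMeets.charSeam_of_meets`
gives the character `ξ` (the central character of `P` read on the line) with a NON-ZERO `ξ`-theta class in `P`; ★
`F0LD1CharThetaSpaceLeOfIrreducible.exists_closedSubrep_thetaSpan` gives the closed invariant theta span `Q` of `(a′, ξ)`, non-zero by the seam, hence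
IRREDUCIBLE by (I′); ★ `….charThetaSpaceLe_of_irreducible`: `Q ∩ P ∋` seam `≠ 0` ⇒ `Q ≤ P` ⇒ every `(a′, ξ)`-theta class lies in `P` = (I-A).

References: [Liu2021] Y. Liu, Camb. J. Math. 9 (2021), App. B Cor. B.6 (1) p. 99; proof of Prop. 4.13 Case 1 p. 48; App. D Prop. D.4 (1) p. 130–131.
[Wu2013] C. Wu, J. Number Theory 133 (2013), Thm. 5.3.  [Rallis1984] S. Rallis, Compositio Math. 51 (1984), §1.  [Dixmier1977] J. Dixmier (1977), §5.4.
[BorelJacquet1979] A. Borel, H. Jacquet, PSPM 33.1 (1979), §4.6.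
-/

set_option autoImplicit false
-- the mandated namespace has the single-problem summit's repeated segment (`HodgeConjecture.HodgeConjecture`)
set_option linter.dupNamespace false

noncomputable section

open NumberField NumberField.InfinitePlace MeasureTheory IsDedekindDomain
open scoped Matrix Kronecker ComplexOrder ENNReal
open Literature.NumberTheory.Automorphic Literature.NumberTheory.Automorphic.UnitaryGroup
open Literature.NumberTheory.Automorphic.UnitaryGroup.CotangentForms
open Literature.NumberTheory.Automorphic.IdeleClassGroup
open Literature.NumberTheory.Automorphic.Liu2021
open Literature.NumberTheory.Automorphic.Liu2021.Def411WeilCarriers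
open Literature.NumberTheory.Automorphic.Liu2021.Def411WeilCarriersDoubling
open Literature.NumberTheory.GaloisRepresentations
open Literature.NumberTheory.GelbartRogawski1991 Literature.NumberTheory.GelbartRogawski1991.UnitaryDualPair
open Literature.NumberTheory.Weil1964
open Literature.RepresentationTheory.Liu2021
open Literature.RepresentationTheory.CompactGroups
open Literature.RepresentationTheory.HeisenbergGroup

namespace Summit.HodgeConjecture.HodgeConjecture.Cruxes.HLiu418.F0LD1ThetaCharRigidOfIrred

set_option maxHeartbeats 1600000 in
-- (as in ★ `F0LD1CharSeamOfMeets`: the theta-kernel datum types are very large)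
/-- **ORGAN (I) `ThetaCharRigid₂` OF THE LD1 θ-ROAD FROM THE LETTER-ORGAN (I′) `ThetaSpaceIrreducible₂`.**  Hypothesis = the body of (I′): for the letter's CM
curve frames (CM `L`, `[L:ℚ] ≥ 4`; `H` of signature `(1,1)` at `ι`, definite elsewhere; scaled frame `ᵗ(c̄ g)·(t • H)·g = diag dV`; conjugate-symplectic `λ` of weight
one), a transport `ιA` pinned by `↑(ιA k) = g_𝔸⁻¹ k g_𝔸`, `[U(diag dV)]` compact, every line `a′` and character `ξ` of `[U(⟨a′⟩)]`: ★ `Liu2021.ThetaLiftFromLineIrreducible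
L 2 H e₁ dV hdV hdV0 ιA μ λ hλ a′ ξ` ([Liu2021, Cor. B.6 (1)] ∕ [Wu2013, Thm. 5.3]).  Conclusion = the body of `ThetaCharRigid₂` (leaf :411) with `CharThetaSpaceLe₂` ∕
`CharSeam₂` unfolded: if a discrete `P` meets the theta lift from `⟨a′⟩` at `λ` along `ιA`, then for some `ξ` EVERY `(a′, ξ)`-theta class lies in `P` and one is
non-zero.  Proof: module docstring ((I-B) ★ `charSeam_of_meets`; theta span ★ `exists_closedSubrep_thetaSpan`; (I′); ★ `charThetaSpaceLe_of_irreducible`).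
[cite: Liu2021, App. B Cor. B.6 (1) p. 99; proof of Prop. 4.13 Case 1 p. 48; App. D proof of Prop. D.4 (1) p. 131] [cite: Wu2013, Thm. 5.3]
[cite: Rallis1984, §1] [cite: Dixmier1977, §5.4] -/
theorem thetaCharRigid₂_of_irred
    (hIrr : ∀ (L : Type) [Field L] [NumberField L] [IsCMField L] (ι : L →+* ℂ) (H : Matrix (Fin 2) (Fin 2) L)
        (dV : Fin 2 → L) (hdV : ∀ i, IsCMField.complexConj L (dV i) = dV i) (hdV0 : ∀ i, dV i ≠ 0)
        (t : L) (ht : t ≠ 0) (g : GL (Fin 2) L)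
        (_hg : formCongr ((IsCMField.complexConj L : L ≃ₐ[(↥(maximalRealSubfield L))] L) : L →+* L) g (t • H) = Matrix.diagonal dV),
        (∃ T : GL (Fin 2) ℂ, formCongr (starRingEnd ℂ) T ((Matrix.diagonal dV).map ι) = Matrix.diagonal ![(1 : ℂ), -1]) →
        (∀ τ' : L →+* ℂ, InfinitePlace.mk τ' ≠ InfinitePlace.mk ι → ((Matrix.diagonal dV).map τ').PosDef) →
        4 ≤ Module.finrank ℚ L →
        ∀ (μ : Measure (adelicGroupData (↥(maximalRealSubfield L)) L (IsCMField.complexConj L) 2 H).automorphicQuotient)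
          [(adelicGroupData (↥(maximalRealSubfield L)) L (IsCMField.complexConj L) 2 H).IsAutomorphicMeasure μ]
          {n' : ℕ} (e₁ : Fin 2 × Fin 1 ≃ Fin n')
          (lam : Literature.NumberTheory.Automorphic.IdeleClassGroup L →ₜ* Circle) (hlam : IsConjugateSymplectic L lam), HasWeight L lam 1 →
        ∀ (ιA : (adelicGroupData (↥(maximalRealSubfield L)) L (IsCMField.complexConj L) 2 H).Adelic →*
            ↥(UnitaryGroup.adelic (↥(maximalRealSubfield L)) L (IsCMField.complexConj L) 2 (Matrix.diagonal dV))),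
          (∀ k, ((ιA k : ↥(UnitaryGroup.adelic (↥(maximalRealSubfield L)) L (IsCMField.complexConj L) 2 (Matrix.diagonal dV))) :
                GL (Fin 2) (AdeleRing (𝓞 L) L)) =
              (toAdeleGL L g)⁻¹ * adelicVal (↥(maximalRealSubfield L)) L (IsCMField.complexConj L) 2 H k * toAdeleGL L g) →
        ∀ [CompactSpace (↥(UnitaryGroup.adelic (↥(maximalRealSubfield L)) L (IsCMField.complexConj L) 2 (Matrix.diagonal dV)) ⧸
            (UnitaryGroup.toAdelic (↥(maximalRealSubfield L)) L (IsCMField.complexConj L) 2 (Matrix.diagonal dV)).range)],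
        ∀ (a' : (↥(maximalRealSubfield L))ˣ)
          (ξ : haveI := normal_range_toAdelic_JW L a'
            PontryaginDual (↥(UnitaryGroup.adelic (↥(maximalRealSubfield L)) L (IsCMField.complexConj L) 1 (JW (↥(maximalRealSubfield L)) L a')) ⧸ (UnitaryGroup.toAdelic (↥(maximalRealSubfield L)) L (IsCMField.complexConj L) 1 (JW (↥(maximalRealSubfield L)) L a')).range)),
          ThetaLiftFromLineIrreducible L 2 H e₁ dV hdV hdV0 ιA μ lam hlam a' ξ) :
    ∀ (L : Type) [Field L] [NumberField L] [IsCMField L] (ι : L →+* ℂ) (H : Matrix (Fin 2) (Fin 2) L)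
      (dV : Fin 2 → L) (hdV : ∀ i, IsCMField.complexConj L (dV i) = dV i) (hdV0 : ∀ i, dV i ≠ 0)
      (t : L) (ht : t ≠ 0) (g : GL (Fin 2) L)
      (_hg : formCongr ((IsCMField.complexConj L : L ≃ₐ[(↥(maximalRealSubfield L))] L) : L →+* L) g (t • H) = Matrix.diagonal dV),
      (∃ T : GL (Fin 2) ℂ, formCongr (starRingEnd ℂ) T ((Matrix.diagonal dV).map ι) = Matrix.diagonal ![(1 : ℂ), -1]) →
      (∀ τ' : L →+* ℂ, InfinitePlace.mk τ' ≠ InfinitePlace.mk ι → ((Matrix.diagonal dV).map τ').PosDef) →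
      4 ≤ Module.finrank ℚ L →
      ∀ (μ : Measure (adelicGroupData (↥(maximalRealSubfield L)) L (IsCMField.complexConj L) 2 H).automorphicQuotient)
        [(adelicGroupData (↥(maximalRealSubfield L)) L (IsCMField.complexConj L) 2 H).IsAutomorphicMeasure μ]
        {n' : ℕ} (e₁ : Fin 2 × Fin 1 ≃ Fin n')
        (lam : Literature.NumberTheory.Automorphic.IdeleClassGroup L →ₜ* Circle) (hlam : IsConjugateSymplectic L lam), HasWeight L lam 1 →
      ∀ (ιA : (adelicGroupData (↥(maximalRealSubfield L)) L (IsCMField.complexConj L) 2 H).Adelic →*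
          ↥(UnitaryGroup.adelic (↥(maximalRealSubfield L)) L (IsCMField.complexConj L) 2 (Matrix.diagonal dV))),
        (∀ k, ((ιA k : ↥(UnitaryGroup.adelic (↥(maximalRealSubfield L)) L (IsCMField.complexConj L) 2 (Matrix.diagonal dV))) :
              GL (Fin 2) (AdeleRing (𝓞 L) L)) =
            (toAdeleGL L g)⁻¹ * adelicVal (↥(maximalRealSubfield L)) L (IsCMField.complexConj L) 2 H k * toAdeleGL L g) →
      ∀ [CompactSpace (↥(UnitaryGroup.adelic (↥(maximalRealSubfield L)) L (IsCMField.complexConj L) 2 (Matrix.diagonal dV)) ⧸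
          (UnitaryGroup.toAdelic (↥(maximalRealSubfield L)) L (IsCMField.complexConj L) 2 (Matrix.diagonal dV)).range)],
      ∀ (P : DiscreteAutomorphicRep (adelicGroupData (↥(maximalRealSubfield L)) L (IsCMField.complexConj L) 2 H) μ)
        (a' : (↥(maximalRealSubfield L))ˣ),
        MeetsThetaLiftFromLine L 2 H e₁ dV hdV hdV0 P lam hlam a' ιA →
        ∃ ξ : (haveI := normal_range_toAdelic_JW L a'
          PontryaginDual (↥(UnitaryGroup.adelic (↥(maximalRealSubfield L)) L (IsCMField.complexConj L) 1 (JW (↥(maximalRealSubfield L)) L a')) ⧸ (UnitaryGroup.toAdelic (↥(maximalRealSubfield L)) L (IsCMField.complexConj L) 1 (JW (↥(maximalRealSubfield L)) L a')).range)),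
        ( -- `CharThetaSpaceLe₂ L H e₁ dV hdV hdV0 P lam hlam a' ιA ξ` BY VALUE
          letI : MeasurableSpace (↥(UnitaryGroup.adelic (↥(maximalRealSubfield L)) L (IsCMField.complexConj L) 1
              (JW (↥(maximalRealSubfield L)) L a')) ⧸
                (UnitaryGroup.toAdelic (↥(maximalRealSubfield L)) L (IsCMField.complexConj L) 1 (JW (↥(maximalRealSubfield L)) L a')).range) :=
            borel _
          haveI := normal_range_toAdelic_JW L a'
          ∀ (hρ : HasThetaMajorants fun
              (p : ↥(UnitaryGroup.adelic (↥(maximalRealSubfield L)) L (IsCMField.complexConj L) 2 (Matrix.diagonal dV)) ×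
                ↥(UnitaryGroup.adelic (↥(maximalRealSubfield L)) L (IsCMField.complexConj L) 1 (JW (↥(maximalRealSubfield L)) L a')))
              (Φ : piSchwartzBruhat (↥(maximalRealSubfield L)) (Fin n')) =>
                pairRep (↥(maximalRealSubfield L)) L (IsCMField.complexConj L) 2 1 e₁ (Matrix.diagonal dV) (JW (↥(maximalRealSubfield L)) L a')
                  (chiSplittingLine L e₁ dV hdV hdV0 (toHeckeCharacter L lam) (isUnitary_toHeckeCharacter L lam)
                    ((isOscillatorChar_toHeckeCharacter_iff lam).mpr hlam) (TW (↥(maximalRealSubfield L)) a')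
                    (isUnit_det_TW (↥(maximalRealSubfield L)) a') (JW (↥(maximalRealSubfield L)) L a') (JW_eq (↥(maximalRealSubfield L)) L a'))
                  p Φ)
            (μW : Measure (↥(UnitaryGroup.adelic (↥(maximalRealSubfield L)) L (IsCMField.complexConj L) 1
              (JW (↥(maximalRealSubfield L)) L a')) ⧸
                (UnitaryGroup.toAdelic (↥(maximalRealSubfield L)) L (IsCMField.complexConj L) 1 (JW (↥(maximalRealSubfield L)) L a')).range))
            (_ : IsFiniteMeasure μW)
            (_ : SMulInvariantMeasure
              (↥(UnitaryGroup.adelic (↥(maximalRealSubfield L)) L (IsCMField.complexConj L) 1 (JW (↥(maximalRealSubfield L)) L a')))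
              (↥(UnitaryGroup.adelic (↥(maximalRealSubfield L)) L (IsCMField.complexConj L) 1 (JW (↥(maximalRealSubfield L)) L a')) ⧸
                (UnitaryGroup.toAdelic (↥(maximalRealSubfield L)) L (IsCMField.complexConj L) 1 (JW (↥(maximalRealSubfield L)) L a')).range)
              μW)
            (Ψ : piSchwartzBruhat (↥(maximalRealSubfield L)) (Fin n'))
            (hθ : MemLp (toQuotFun (adelicGroupData (↥(maximalRealSubfield L)) L (IsCMField.complexConj L) 2 H) fun x =>
              (lineThetaKernelDatum L 2 e₁ dV hdV hdV0 lam hlam a' hρ).thetaLiftFun μW Ψ (charCM ξ) (ιA x)) 2 μ),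
            MemLp.toLp _ hθ ∈ P.space.toSubmodule) ∧
        ( -- `CharSeam₂ L H e₁ dV hdV hdV0 P lam hlam a' ιA ξ` BY VALUE
          letI : MeasurableSpace (↥(UnitaryGroup.adelic (↥(maximalRealSubfield L)) L (IsCMField.complexConj L) 1
              (JW (↥(maximalRealSubfield L)) L a')) ⧸
                (UnitaryGroup.toAdelic (↥(maximalRealSubfield L)) L (IsCMField.complexConj L) 1 (JW (↥(maximalRealSubfield L)) L a')).range) :=
            borel _
          haveI := normal_range_toAdelic_JW L a'
          ∃ (hρ : HasThetaMajorants fun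
              (p : ↥(UnitaryGroup.adelic (↥(maximalRealSubfield L)) L (IsCMField.complexConj L) 2 (Matrix.diagonal dV)) ×
                ↥(UnitaryGroup.adelic (↥(maximalRealSubfield L)) L (IsCMField.complexConj L) 1 (JW (↥(maximalRealSubfield L)) L a')))
              (Φ : piSchwartzBruhat (↥(maximalRealSubfield L)) (Fin n')) =>
                pairRep (↥(maximalRealSubfield L)) L (IsCMField.complexConj L) 2 1 e₁ (Matrix.diagonal dV) (JW (↥(maximalRealSubfield L)) L a')
                  (chiSplittingLine L e₁ dV hdV hdV0 (toHeckeCharacter L lam) (isUnitary_toHeckeCharacter L lam)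
                    ((isOscillatorChar_toHeckeCharacter_iff lam).mpr hlam) (TW (↥(maximalRealSubfield L)) a')
                    (isUnit_det_TW (↥(maximalRealSubfield L)) a') (JW (↥(maximalRealSubfield L)) L a') (JW_eq (↥(maximalRealSubfield L)) L a'))
                  p Φ)
            (μW : Measure (↥(UnitaryGroup.adelic (↥(maximalRealSubfield L)) L (IsCMField.complexConj L) 1
              (JW (↥(maximalRealSubfield L)) L a')) ⧸
                (UnitaryGroup.toAdelic (↥(maximalRealSubfield L)) L (IsCMField.complexConj L) 1 (JW (↥(maximalRealSubfield L)) L a')).range))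
            (_ : IsFiniteMeasure μW)
            (_ : SMulInvariantMeasure
              (↥(UnitaryGroup.adelic (↥(maximalRealSubfield L)) L (IsCMField.complexConj L) 1 (JW (↥(maximalRealSubfield L)) L a')))
              (↥(UnitaryGroup.adelic (↥(maximalRealSubfield L)) L (IsCMField.complexConj L) 1 (JW (↥(maximalRealSubfield L)) L a')) ⧸
                (UnitaryGroup.toAdelic (↥(maximalRealSubfield L)) L (IsCMField.complexConj L) 1 (JW (↥(maximalRealSubfield L)) L a')).range)
              μW)
            (Ψ : piSchwartzBruhat (↥(maximalRealSubfield L)) (Fin n'))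
            (hθ : MemLp (toQuotFun (adelicGroupData (↥(maximalRealSubfield L)) L (IsCMField.complexConj L) 2 H) fun x =>
              (lineThetaKernelDatum L 2 e₁ dV hdV hdV0 lam hlam a' hρ).thetaLiftFun μW Ψ (charCM ξ) (ιA x)) 2 μ),
            MemLp.toLp _ hθ ∈ P.space.toSubmodule ∧ MemLp.toLp _ hθ ≠ 0) := by
  intro L _ _ _ ι H dV hdV hdV0 t ht g hg hsig hdef h4 μ _ n' e₁ lam hlam hw ιA hιA _ P a' hmeet
  -- `[U(H)]` is compact: `H` is definite at a complex place off `ι`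
  obtain ⟨τ, hτ⟩ := UnitaryGroup.exists_infinitePlace_ne L h4 ι
  haveI := UnitaryGroup.compactSpace_adelicGroupData_automorphicQuotient L 2 H
    (S1BettiSliceExclusion.anisotropic_of_formCongr_posDef L H t g dV hg τ (hdef τ hτ))
  -- (I-B): the character `ξ` with a non-zero `ξ`-theta class in `P`
  obtain ⟨ξ, hseam⟩ := F0LD1CharSeamOfMeets.charSeam_of_meets L 2 H e₁ dV hdV hdV0 t ht g hg ιA hιA P lam hlam a' hmeet
  -- the closed invariant theta span `Q` of `(a′, ξ)`; non-zero (it contains the seam's class), hence irreducible by (I′)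
  obtain ⟨Q, hQ, hQcl⟩ :=
    F0LD1CharThetaSpaceLeOfIrreducible.exists_closedSubrep_thetaSpan (μA := μ) L 2 H e₁ dV hdV hdV0 t ht g hg ιA hιA lam hlam a' ξ
  have hQne : Q.toSubmodule ≠ ⊥ := by
    obtain ⟨hρ, μW, hfin, hinv, Ψ, hθ, -, hne⟩ := hseam
    intro hbot
    have h := hQ hρ μW hfin hinv Ψ hθ
    rw [hbot, Submodule.mem_bot] at h
    exact hne h
  have hQirr : Q.toContRep.IsTopIrreducible :=
    (hIrr L ι H dV hdV hdV0 t ht g hg hsig hdef h4 μ e₁ lam hlam hw ιA hιA a' ξ Q hQcl).resolve_left hQne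
  -- (I-A): `Q ∩ P ∋` the seam `≠ 0`, so `Q ≤ P`
  exact ⟨ξ, F0LD1CharThetaSpaceLeOfIrreducible.charThetaSpaceLe_of_irreducible L 2 H e₁ dV hdV hdV0 ιA P lam hlam a' ξ Q hQirr hQ hseam, hseam⟩

end Summit.HodgeConjecture.HodgeConjecture.Cruxes.HLiu418.F0LD1ThetaCharRigidOfIrred

end
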